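import Summits.QuantumFields.YangMills.Theorems.BalabanUVNodesN15TwoSpacingGluingNeumannRemainder
import Summits.QuantumFields.YangMills.Theorems.BalabanUVNodesN15TwoGridLandauReduction
import Summits.QuantumFields.YangMills.Theorems.BalabanUVNodesN15TwoGridEntries
import HarnessLib

/-!
# THE GLUING STEP AT TWO LATTICE SPACINGS, XXVIII: THE KNIT — ON THE DOUBLED TORUS `M_ν = 2L^{m+1}` THE GLUED OPERATOR `G₀(1 − R)⁻¹` BUILT FROM THE `(2L)^{d+1}` TRANSLATED
# NEUMANN CUBES AND THE SAMPLED PARTITION (2.36) IS THE TWO-SIDED INVERSE OF BAŁABAN's `Δ_a` (hence `= G`) AND DECAYS, FOR `L^m ≥ w₀` — [B9] Thm 3.1's «M ≥ M₁» LIVE, EVERY HYPOTHESIS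
# OF FILES 43–69 DISCHARGED BY NAME (dag-n15-c g12, FILE 70 = (Γ14′) of the g11 HANDOFF; N15 = NE2, s1 «background-layer OPERATOR ingredient»)

Cell `pub-ymgap`, seat `pub-ymgap-dag-n15-c` (R134 (a); HUMAN RULING D-0062), generation 12.  `bears_on: R4∕N15 · K3⁷ SpineGivenEndpointR13SepCoPH (stmt-QuantumFields-20544)`.
Filed `--supports stmt-QuantumFields-20544 --as helper` — COUNT-NEUTRAL.  One plumbing `def` (`coverMargin`), the rest theorems; 0 `sorry`.  Imports BY NAME FILE 69 (through it 43–68 and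
dag-n15-a's PROGRAMME N), dag-n15-a parts 41∕47 (`hasMaj_landauRe`, `ineq110_114_pair`, `hasMaj_gOp_of_ineq`, `hasMaj_grad_of_ineq`); nothing in the tree is modified.

WHAT.  On dag-n15-a's torus `M = MP (paramsOf d L (m+1) k hL)` (`M_ν = 2L^{m+1}`, coarse spacing `L^{−k}`), with `w = L^m`, `q = L`, cube side `Lw = L^{m+1}`, margin `m₀ = coverMargin L m =
((L−2)L^m − 1)∕2`, partition `h_k = hcube (2L) (coverXi M (L^k) (L^m)) k`, cubes `G(□_k) = neumannCubeG M (L^k) (coverCorner M (L^m) L m₀ k) (L·L^m) a`: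
* §1 `coverMargin`, ★ `coverMargin_fit` (`2m₀ + 2w + 1 ≤ Lw`), `le_two_mul_coverMargin` (`w ≤ 2(m₀+1)`), `MP_succ_eq`; §2 ★★ `remainderConst_le` (FILE 69's `θ₀ ≤ κ₀∕w`);
* §3 ★★★ **`glued_cover_inverse`**: `∃ w₀, ∀ m k (hk : 1 ≤ k), w₀ ≤ L^m →` (i) `Δ_a∘G_glued = 1`, (ii) `G_glued∘Δ_a = 1`, (iii) `G_glued = G` (the torus propagator: uniqueness), where
  `G_glued = glueInv (parametrix h G(□)) (remainder Δ_a h G(□))` — (2.36) `sum_coverH_sq`, per-cube locality N-IIIa `mulOp_comp_deltaOp_comp_neumannCubeG` on FILE 66 `mem_intBonds_of_hcube_ne_zero`,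
  (2.91) FILE 45 `lap_comp_parametrix`, the unit from the smallness (FILE 43 `isUnit_neumannR`) fed by FILE 69's row and §2;
* ★★★ **`hasMaj_glued_cover`**: `∃ δ w₀ B > 0, ∀ m k (hk), w₀ ≤ L^m → G_glued ≤ B·e^{−δ|y−y′|_T}` — FILE 43 `hasMaj_glueInv_of_M` on FILE 45 `hasMaj_parametrix` (cut by FILE 63 `parametrix_cut`)
  and FILE 57 `hasMaj_remainder_in` fed by FILE 69; `B, δ, w₀` uniform in `m, k`.

HONEST FRAMING ∕ LIMITS.  This is the COMPOSITION CERTIFICATE of [B6] §2's parametrix machine ((2.36)–(2.37) p.229, (2.91)–(2.93) p.239, (2.133)–(2.136) p.247) at `U ≡ 1` on dag-n15-a's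
doubled-cube torus MODEL: cube = half torus, glued operator = THE torus propagator (iii), whose letters were the INPUT (dag-n15-a part 12 ∕ (1.110)) — as an ESTIMATE it is circular; what is
certified is that every hypothesis of FILES 43–63 (cube rows, partition letters, cuts, overlap, margin, smallness) is inhabited with the convergence guard `L^m ≥ w₀` LIVE and constants
uniform in the volume exponent `m` and the spacing exponent `k`.  The non-circular edition = dag-n15-a PROGRAMME P (cubes of fixed side lifted to the torus of record) + the background-live
cube letters (dag-n15-w3); the η-defect ∕ `NE2PlusOperator` socket (FILE 50) is the sequel.  Nothing of [B5]∕[B6]∕[B9] asserted.  NE2⁺ NOT PRINTED, NOT proved; N15 NOT discharged; counts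
of record UNMOVED (typed 28∕28 · discharged 5∕27); one finite 𝕋⁴ at fixed ε — NOT infinite volume, NOT OS on ℝ⁴, NOT a mass gap, NOT Clay; R4 closes the conditional finite-𝕋⁴ rung
`BalabanLadder.UV` only.  Restate-immune (no Theses import).
-/

noncomputable section

namespace Summit.QuantumFields.YangMills.BalabanUVNodes.N15.Gluing

open Real
open Literature.MathematicalPhysics.QuantumFieldTheory.Balaban1983to89
open Literature.MathematicalPhysics.QuantumFieldTheory.Balaban1983to89.B5Prop11Plancherel (Tor fine)
open Literature.MathematicalPhysics.QuantumFieldTheory.Balaban1983to89.B11SectG (BlockNorm HasMaj RowSum)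
open Literature.MathematicalPhysics.QuantumFieldTheory.Balaban1983to89.B6Prop26Gluing (mulOp ind ind_nonneg ind_le_one)
open Literature.MathematicalPhysics.QuantumFieldTheory.Balaban1983to89.B6UnitTorusCarrier (unitTorusGeo triangle254_unitTorusGeo rowSum_unitTorusGeo unitTorusGeo_dist_nonneg
  unitTorusGeo_dist_self)
open Literature.MathematicalPhysics.QuantumFieldTheory.Balaban1983to89.B5SiteBridgeP12 (MP)
open Literature.MathematicalPhysics.QuantumFieldTheory.King1986.Torus (blockOf tdistT tdistT_nonneg)
open Summit.QuantumFields.YangMills.BalabanUVNodes.N15.VectorPiece (bshiftEquiv)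
open Summit.QuantumFields.YangMills.BalabanUVNodes.N15.TwoGrid (paramsOf deltaOp gOp neumannCubeG chiCube cubeBlocks hasMaj_chiCube_symOp_comp hasMaj_comp_mulOp_chiInt
  mulOp_comp_deltaOp_comp_neumannCubeG gOp_comp_deltaOp ineq110_114_pair hasMaj_gOp_of_ineq hasMaj_grad_of_ineq hasMaj_landauRe)

variable {d : ℕ}

/-! ## §1 The parameters of the knit -/

section Params

/-- THE MARGIN of the cover on the doubled torus `M_ν = 2L^{m+1}` (cube side `L·L^m`, partition resolution `w = L^m`): `m₀ = ((L − 2)L^m − 1)∕2` blocks. [cite: Balaban1984PropagatorsII, p.239 («ζ_□ … distance ⅓M»: shape)] -/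
def coverMargin (L m : ℕ) : ℕ := ((L - 2) * L ^ m - 1) / 2

/-- ★ the window inequality of FILES 66–69: `2m₀ + 2w + 1 ≤ Lw` (`L ≥ 3`). [folklore] -/
theorem coverMargin_fit {L : ℕ} (hL : 3 ≤ L) (m : ℕ) : 2 * coverMargin L m + 2 * L ^ m + 1 ≤ L * L ^ m := by
  unfold coverMargin
  have hw : 1 ≤ L ^ m := Nat.one_le_pow _ _ (by omega)
  have h1 : 2 * (((L - 2) * L ^ m - 1) / 2) ≤ (L - 2) * L ^ m - 1 := Nat.mul_div_le _ 2
  have h2 : (L - 2) * L ^ m + 2 * L ^ m = L * L ^ m := by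
    rw [← Nat.add_mul, Nat.sub_add_cancel (by omega)]
  have h3 : 1 ≤ (L - 2) * L ^ m := Nat.one_le_iff_ne_zero.mpr (Nat.mul_ne_zero (by omega) (by omega))
  omega

/-- the margin is at least half the resolution: `w ≤ 2(m₀ + 1)` (`L ≥ 3`). [folklore] -/
theorem le_two_mul_coverMargin {L : ℕ} (hL : 3 ≤ L) (m : ℕ) : L ^ m ≤ 2 * (coverMargin L m + 1) := by
  unfold coverMargin
  have h1 : (L - 2) * L ^ m - 1 < 2 * (((L - 2) * L ^ m - 1) / 2 + 1) := by omega
  have h3 : L ^ m ≤ (L - 2) * L ^ m := Nat.le_mul_of_pos_left _ (by omega)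
  omega

/-- dag-n15-a's doubled torus at volume exponent `m + 1` has `M_ν = 2·L·L^m`. [folklore] -/
theorem MP_succ_eq (L m k : ℕ) (hL : Odd L ∧ 1 < L) (ν : Fin (d + 1)) : MP (paramsOf d L (m + 1) k hL) ν = 2 * L * L ^ m := by
  show 2 * L ^ (m + 1) = 2 * L * L ^ m
  rw [pow_succ]; ring

end Params

/-! ## §2 The remainder constant is `O(w⁻¹)` -/

section Small

/-- ★★ **FILE 69's remainder constant `θ₀(w, m₀) ≤ κ₀∕w`** for `1 ≤ w ≤ 2(m₀ + 1)`, with `κ₀` free of `w, m₀` (every letter of FILE 69 is `O(w⁻¹)`; the margin term `e^{−(δ_m∕4)(m₀+1)} ≤ 8∕(δ_m w)`).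
[cite: Balaban1984PropagatorsII, (2.134)–(2.135) p.247 («O(M⁻¹)»: shape)] -/
theorem remainderConst_le (d : ℕ) {a C δ₀ C₁ δ₁ cr w m₀ : ℝ} (hC : 0 ≤ C) (hδ₀ : 0 < δ₀) (hC₁ : 0 ≤ C₁) (hδ₁ : 0 < δ₁) (hcr : 0 ≤ cr) (hw : 1 ≤ w) (hwm : w ≤ 2 * (m₀ + 1)) :
    (((d + 1 : ℕ) * (32 * π ^ 2 / w ^ 2 * (2 ^ (d + 1) * (C * Real.exp δ₀)) + 2 * (π / w * (2 ^ (d + 1) * (C * Real.exp δ₀ * Real.exp δ₀)))) + 0) +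
            2 ^ (d + 1) * ((π * (d + 1) / w * (Real.exp 1 * (min δ₀ δ₁ / 4))⁻¹ + 2 * (π * (d + 1) / w)) * (|a| * (Real.exp (min δ₀ δ₁) * Real.exp (min δ₀ δ₁)) + C₁) *
              (C * Real.exp δ₀) * cr) +
            (|a| * (Real.exp (min δ₀ δ₁) * Real.exp (min δ₀ δ₁)) + C₁) * Real.exp (-((min δ₀ δ₁ - (min δ₀ δ₁ - min δ₀ δ₁ / 4)) * (m₀ + 1))) *
              (2 ^ (d + 1) * (C * Real.exp δ₀)) * cr) ≤
      ((d + 1 : ℕ) * (32 * π ^ 2 * (2 ^ (d + 1) * (C * Real.exp δ₀)) + 2 * (π * (2 ^ (d + 1) * (C * Real.exp δ₀ * Real.exp δ₀)))) +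
        2 ^ (d + 1) * ((π * (d + 1) * (Real.exp 1 * (min δ₀ δ₁ / 4))⁻¹ + 2 * (π * (d + 1))) * (|a| * (Real.exp (min δ₀ δ₁) * Real.exp (min δ₀ δ₁)) + C₁) * (C * Real.exp δ₀) * cr) +
        (|a| * (Real.exp (min δ₀ δ₁) * Real.exp (min δ₀ δ₁)) + C₁) * (8 / min δ₀ δ₁) * (2 ^ (d + 1) * (C * Real.exp δ₀)) * cr) / w := by
  have hδm : 0 < min δ₀ δ₁ := lt_min hδ₀ hδ₁
  have hw0 : 0 < w := by linarith
  set β : ℝ := 2 ^ (d + 1) * (C * Real.exp δ₀) with hβ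
  set β₁ : ℝ := 2 ^ (d + 1) * (C * Real.exp δ₀ * Real.exp δ₀) with hβ₁
  set cN : ℝ := |a| * (Real.exp (min δ₀ δ₁) * Real.exp (min δ₀ δ₁)) + C₁ with hcN
  set E : ℝ := (Real.exp 1 * (min δ₀ δ₁ / 4))⁻¹ with hE
  have hβ0 : 0 ≤ β := by positivity
  have hcN0 : 0 ≤ cN := by positivity
  -- term 1: `1∕w² ≤ 1∕w`
  have t1 : ((d + 1 : ℕ) * (32 * π ^ 2 / w ^ 2 * β + 2 * (π / w * β₁))) + 0 ≤ (d + 1 : ℕ) * (32 * π ^ 2 * β + 2 * (π * β₁)) / w := by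
    have hsq : 32 * π ^ 2 / w ^ 2 * β ≤ 32 * π ^ 2 * β / w := by
      rw [div_mul_eq_mul_div]
      exact div_le_div_of_nonneg_left (by positivity) hw0 (by nlinarith)
    have e2 : (d + 1 : ℕ) * (32 * π ^ 2 * β + 2 * (π * β₁)) / w = (d + 1 : ℕ) * (32 * π ^ 2 * β / w + 2 * (π / w * β₁)) := by ring
    rw [e2, add_zero]
    exact mul_le_mul_of_nonneg_left (by linarith) (by positivity)
  -- term 2: exact rearrangement
  have t2 : 2 ^ (d + 1) * ((π * (d + 1) / w * E + 2 * (π * (d + 1) / w)) * cN * (C * Real.exp δ₀) * cr) =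
      2 ^ (d + 1) * ((π * (d + 1) * E + 2 * (π * (d + 1))) * cN * (C * Real.exp δ₀) * cr) / w := by ring
  -- term 3: the margin, `e^{−(δ_m∕4)(m₀+1)} ≤ 8∕(δ_m w)`
  have t3 : cN * Real.exp (-((min δ₀ δ₁ - (min δ₀ δ₁ - min δ₀ δ₁ / 4)) * (m₀ + 1))) * β * cr ≤ cN * (8 / min δ₀ δ₁) * β * cr / w := by
    have hx : 0 < min δ₀ δ₁ / 4 * (m₀ + 1) := mul_pos (by positivity) (by linarith)
    have hexp : Real.exp (-((min δ₀ δ₁ - (min δ₀ δ₁ - min δ₀ δ₁ / 4)) * (m₀ + 1))) ≤ (min δ₀ δ₁ / 4 * (m₀ + 1))⁻¹ := by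
      rw [show (min δ₀ δ₁ - (min δ₀ δ₁ - min δ₀ δ₁ / 4)) * (m₀ + 1) = min δ₀ δ₁ / 4 * (m₀ + 1) by ring]
      rw [Real.exp_neg]
      exact inv_anti₀ hx (by linarith [Real.add_one_le_exp (min δ₀ δ₁ / 4 * (m₀ + 1))])
    have hinv : (min δ₀ δ₁ / 4 * (m₀ + 1))⁻¹ ≤ (min δ₀ δ₁ * w / 8)⁻¹ := inv_anti₀ (by positivity) (by nlinarith)
    calc cN * Real.exp (-((min δ₀ δ₁ - (min δ₀ δ₁ - min δ₀ δ₁ / 4)) * (m₀ + 1))) * β * cr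
        = cN * β * cr * Real.exp (-((min δ₀ δ₁ - (min δ₀ δ₁ - min δ₀ δ₁ / 4)) * (m₀ + 1))) := by ring
      _ ≤ cN * β * cr * (min δ₀ δ₁ * w / 8)⁻¹ := mul_le_mul_of_nonneg_left (hexp.trans hinv) (by positivity)
      _ = cN * (8 / min δ₀ δ₁) * β * cr / w := by
          field_simp
  have hsum : (d + 1 : ℕ) * (32 * π ^ 2 * β + 2 * (π * β₁)) / w + 2 ^ (d + 1) * ((π * (d + 1) * E + 2 * (π * (d + 1))) * cN * (C * Real.exp δ₀) * cr) / w +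
      cN * (8 / min δ₀ δ₁) * β * cr / w =
      ((d + 1 : ℕ) * (32 * π ^ 2 * β + 2 * (π * β₁)) + 2 ^ (d + 1) * ((π * (d + 1) * E + 2 * (π * (d + 1))) * cN * (C * Real.exp δ₀) * cr) + cN * (8 / min δ₀ δ₁) * β * cr) / w := by
    ring
  linarith [t1, t2.le, t3, hsum.le, hsum.ge]

end Small

/-! ## §3 The knit on the doubled torus -/

section Knit

variable (d) (L : ℕ) [NeZero L]

/-- THE COVER's PARTITION FAMILY at spacing `n` on the doubled torus `M = MP (paramsOf d L (m+1) k hL)` (`M_ν = 2L·L^m`): `h_k = Π_ν Θ_{2L}(x_ν∕(nL^m) − k_ν)`, `k ∈ (ℤ∕2L)^{d+1}`. [cite: Balaban1984PropagatorsII, (2.36) p.229 (shape)] -/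
def knitH (m kk n : ℕ) (hL : Odd L ∧ 1 < L) (k : Fin (d + 1) → ZMod (2 * L)) : Tor (fine n (MP (paramsOf d L (m + 1) kk hL))) × Fin (d + 1) → ℝ :=
  hcube (2 * L) (coverXi (MP (paramsOf d L (m + 1) kk hL)) n (L ^ m)) k

/-- THE COVER's CUBE FAMILY: the Neumann-by-images propagators of the translated cubes `□_k = c(k) + [0, L·L^m)^{d+1}`. [cite: Balaban1984PropagatorsII, (2.37) p.229 (shape)] -/
def knitG (m kk n : ℕ) [NeZero n] (hL : Odd L ∧ 1 < L) (a : ℝ) (k : Fin (d + 1) → ZMod (2 * L)) :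
    (Tor (fine n (MP (paramsOf d L (m + 1) kk hL))) × Fin (d + 1) → ℝ) →ₗ[ℝ] (Tor (fine n (MP (paramsOf d L (m + 1) kk hL))) × Fin (d + 1) → ℝ) :=
  neumannCubeG (MP (paramsOf d L (m + 1) kk hL)) n (coverCorner (MP (paramsOf d L (m + 1) kk hL)) (L ^ m) L (coverMargin L m) k) (L * L ^ m) a

/-- THE GLUED OPERATOR `G₀(1 − R)⁻¹` of the cover (FILE 43 `glueInv` of FILE 45's `parametrix` ∕ `remainder` for Bałaban's `Δ_a` at `U ≡ 1`). [cite: Balaban1984PropagatorsII, (2.91) p.239, p.247 («G = G₀(I − R)⁻¹»)] -/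
def knitGlued (m kk n : ℕ) [NeZero n] (hL : Odd L ∧ 1 < L) (a : ℝ) :
    (Tor (fine n (MP (paramsOf d L (m + 1) kk hL))) × Fin (d + 1) → ℝ) →ₗ[ℝ] (Tor (fine n (MP (paramsOf d L (m + 1) kk hL))) × Fin (d + 1) → ℝ) :=
  glueInv (parametrix (knitH d L m kk n hL) (knitG d L m kk n hL a)) (remainder (deltaOp (MP (paramsOf d L (m + 1) kk hL)) n a) (knitH d L m kk n hL) (knitG d L m kk n hL a))

variable {d L}

/-- ★★★ **THE KNIT, STRUCTURE**: for `L^m ≥ w₀` (uniform in `m` and the spacing exponent `k ≥ 1`), the glued operator of the cover at spacing `L^{−k}` is a TWO-SIDED inverse of `Δ_a` on the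
doubled torus, hence IS the torus propagator `G = Δ_a⁻¹` — (2.36) `sum_coverH_sq`, per-cube locality N-IIIa on FILE 66's `supp h_k ⊂ intBonds(□_k)`, (2.91) FILE 45 `lap_comp_parametrix`, the
unit of `1 − R` from the smallness `N_ov·(κ₀∕L^m)·c_r < 1` (FILE 43 `isUnit_neumannR`, FILE 57 `hasMaj_remainder_in`, FILE 69, §2), uniqueness FILE 43 `eq_glueInv_of_comp_lap`.
[cite: Balaban1984PropagatorsII, (2.91) p.239, p.247 («G = G₀(I − R)⁻¹»: mechanism); Balaban1985BackgroundPropagators, Thm 3.1 p.397 («for M ≥ M₁»: the guard, here `L^m ≥ w₀`)] -/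
theorem knitGlued_spec (hL : Odd L ∧ 1 < L) {a : ℝ} (ha : 0 < a) :
    ∃ δ w₀ B : ℝ, 0 < δ ∧ 0 < B ∧ ∀ (m kk : ℕ), 1 ≤ kk → w₀ ≤ ((L ^ m : ℕ) : ℝ) →
      (deltaOp (MP (paramsOf d L (m + 1) kk hL)) (L ^ kk) a ∘ₗ knitGlued d L m kk (L ^ kk) hL a = LinearMap.id ∧
        knitGlued d L m kk (L ^ kk) hL a ∘ₗ deltaOp (MP (paramsOf d L (m + 1) kk hL)) (L ^ kk) a = LinearMap.id ∧
        knitGlued d L m kk (L ^ kk) hL a = gOp (MP (paramsOf d L (m + 1) kk hL)) (L ^ kk) a) ∧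
      HasMaj (BlockNorm.ofBlocks (unitTorusGeo L kk (MP (paramsOf d L (m + 1) kk hL)))
          (fun b : Tor (fine (L ^ kk) (MP (paramsOf d L (m + 1) kk hL))) × Fin (d + 1) => blockOf (L ^ kk) (MP (paramsOf d L (m + 1) kk hL)) b.1))
        (BlockNorm.ofBlocks (unitTorusGeo L kk (MP (paramsOf d L (m + 1) kk hL)))
          (fun b : Tor (fine (L ^ kk) (MP (paramsOf d L (m + 1) kk hL))) × Fin (d + 1) => blockOf (L ^ kk) (MP (paramsOf d L (m + 1) kk hL)) b.1))
        (knitGlued d L m kk (L ^ kk) hL a) (fun y y' => B * Real.exp (-(δ * tdistT (MP (paramsOf d L (m + 1) kk hL)) y y'))) := by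
  obtain ⟨δ₀, C, Cα, Cε, Cαε, hδ₀, hC, H⟩ := ineq110_114_pair (d := d) hL ha
  obtain ⟨δ₁, C₁, hδ₁, hC₁, HL⟩ := hasMaj_landauRe (d := d) (L := L)
  set cr : ℝ := B4Sect5Proof.latticeConst (d + 1) (min δ₀ δ₁ / 4) with hcr_def
  set κ₀ : ℝ := ((d + 1 : ℕ) * (32 * π ^ 2 * (2 ^ (d + 1) * (C * Real.exp δ₀)) + 2 * (π * (2 ^ (d + 1) * (C * Real.exp δ₀ * Real.exp δ₀)))) +
    2 ^ (d + 1) * ((π * (d + 1) * (Real.exp 1 * (min δ₀ δ₁ / 4))⁻¹ + 2 * (π * (d + 1))) * (|a| * (Real.exp (min δ₀ δ₁) * Real.exp (min δ₀ δ₁)) + C₁) * (C * Real.exp δ₀) * cr) +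
    (|a| * (Real.exp (min δ₀ δ₁) * Real.exp (min δ₀ δ₁)) + C₁) * (8 / min δ₀ δ₁) * (2 ^ (d + 1) * (C * Real.exp δ₀)) * cr) with hκ₀_def
  set Nov : ℝ := (((2 * L) ^ (d + 1) : ℕ) : ℝ) with hNov
  set β : ℝ := 2 ^ (d + 1) * (C * Real.exp δ₀) with hβdef
  have hδm : 0 < min δ₀ δ₁ := lt_min hδ₀ hδ₁
  have hcr : 0 ≤ cr := B4Sect5Proof.latticeConst_nonneg (d + 1) (by positivity)
  have hκ₀ : 0 ≤ κ₀ := by positivity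
  have hβ0 : 0 ≤ β := by positivity
  refine ⟨min δ₀ δ₁ / 4, 2 * (Nov * κ₀) * cr + 1, 2 * (Nov * β) * cr + 1, by positivity, by positivity, fun m kk hk hw₀ => ?_⟩
  have hL3 : 3 ≤ L := by obtain ⟨⟨j, hj⟩, h1⟩ := hL; omega
  set M : Fin (d + 1) → ℕ := MP (paramsOf d L (m + 1) kk hL) with hMdef
  have hM : ∀ ν, M ν = 2 * L * L ^ m := MP_succ_eq L m kk hL
  have hM' : ∀ ν, M ν = 2 * (L * L ^ m) := fun ν => by rw [hM ν, mul_assoc]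
  have hw : 0 < L ^ m := pow_pos (by omega) m
  have hn : 1 ≤ L ^ kk := Nat.one_le_pow _ _ (by omega)
  have hwR : (1 : ℝ) ≤ ((L ^ m : ℕ) : ℝ) := by exact_mod_cast hw
  have hwpos : (0 : ℝ) < ((L ^ m : ℕ) : ℝ) := by linarith
  have hfit := coverMargin_fit hL3 m
  have hfit1 : coverMargin L m + 2 * L ^ m + 1 ≤ L * L ^ m := by omega
  have hwm : ((L ^ m : ℕ) : ℝ) ≤ 2 * ((coverMargin L m : ℝ) + 1) := by exact_mod_cast le_two_mul_coverMargin hL3 m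
  -- the letters at spacing `L^kk`
  have Hk := (H (m + 1) kk 0 hk).1
  have hG := hasMaj_gOp_of_ineq (L := L) (k := kk) M (L ^ kk) a hn Hk hC.le
  have hD := fun ν => hasMaj_grad_of_ineq (L := L) (k := kk) M (L ^ kk) a hn Hk hC.le ν
  have hNL := HL kk (L ^ kk) M
  -- the remainder rows with `θ₀ ≤ κ₀ ∕ L^m`
  have hΘ := remainderConst_le d (a := a) hC.le hδ₀ hC₁.le hδ₁ hcr hwR hwm
  have hK : ∀ k : Fin (d + 1) → ZMod (2 * L),
      HasMaj (BlockNorm.ofBlocks (unitTorusGeo L kk M) (fun b : Tor (fine (L ^ kk) M) × Fin (d + 1) => blockOf (L ^ kk) M b.1))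
        (BlockNorm.ofBlocks (unitTorusGeo L kk M) (fun b : Tor (fine (L ^ kk) M) × Fin (d + 1) => blockOf (L ^ kk) M b.1))
        (commOp (deltaOp M (L ^ kk) a) (knitH d L m kk (L ^ kk) hL k) ∘ₗ knitG d L m kk (L ^ kk) hL a k)
        (fun y y' => ind ((cubeBlocks M (coverCorner M (L ^ m) L (coverMargin L m) k) (L * L ^ m) : Finset (Tor M)) : Set (Tor M)) y' *
          (κ₀ / ((L ^ m : ℕ) : ℝ) * Real.exp (-(min δ₀ δ₁ / 2 * tdistT M y y')))) := fun k =>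
    (hasMaj_commOp_deltaOp_comp_neumannCubeG (L := L) (kk := kk) hM hw hfit hC hδ₀ hC₁.le hδ₁ hG hD hNL k).mono fun y y' =>
      mul_le_mul_of_nonneg_left (mul_le_mul_of_nonneg_right hΘ (Real.exp_nonneg _)) (ind_nonneg _ _)
  have hh : ∀ (k : Fin (d + 1) → ZMod (2 * L)) x, |knitH d L m kk (L ^ kk) hL k x| ≤ 1 := fun k x => abs_coverH_le_one k x
  have hN := fun y => sum_ind_cubeBlocks_le (M := M) (w := L ^ m) (q := L) (m₀ := coverMargin L m) L kk y
  have hrow := rowSum_unitTorusGeo (L := L) (k := kk) (M := M) (σ := min δ₀ δ₁ / 4) (by positivity)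
  have hR := hasMaj_remainder_in (g := unitTorusGeo L kk M) (fun b : Tor (fine (L ^ kk) M) × Fin (d + 1) => blockOf (L ^ kk) M b.1)
    (fun k => ((cubeBlocks M (coverCorner M (L ^ m) L (coverMargin L m) k) (L * L ^ m) : Finset (Tor M)) : Set (Tor M)))
    (Δ := deltaOp M (L ^ kk) a) (h := knitH d L m kk (L ^ kk) hL) (G := knitG d L m kk (L ^ kk) hL a) (θ₀ := κ₀ / ((L ^ m : ℕ) : ℝ)) (δ := min δ₀ δ₁ / 2) (Nov := Nov)
    (by positivity) hh hN hK
  have hMge : 2 * (Nov * κ₀) * cr ≤ ((L ^ m : ℕ) : ℝ) := by linarith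
  obtain ⟨hq, -⟩ := glued_smallness_of_M (cr := cr) (κ₀ := κ₀) (Nov := Nov) hwpos hMge
  have hunit := isUnit_neumannR (g := unitTorusGeo L kk M) (fun b : Tor (fine (L ^ kk) M) × Fin (d + 1) => blockOf (L ^ kk) M b.1) (unitTorusGeo_dist_nonneg L kk M) hrow
    (by positivity) (by linarith : min δ₀ δ₁ / 4 ≤ min δ₀ δ₁ / 2) hR hq
  -- (2.91) from (2.36) and per-cube locality
  have hloc : ∀ k, mulOp (knitH d L m kk (L ^ kk) hL k) ∘ₗ deltaOp M (L ^ kk) a ∘ₗ knitG d L m kk (L ^ kk) hL a k = mulOp (knitH d L m kk (L ^ kk) hL k) := fun k =>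
    mulOp_comp_deltaOp_comp_neumannCubeG M (L ^ kk) (coverCorner M (L ^ m) L (coverMargin L m) k) (L * L ^ m) a hM' hn ha
      fun b hb => mem_intBonds_of_hcube_ne_zero (m₀ := coverMargin L m) hM hw hfit1 hb
  have h291 := lap_comp_parametrix (Δ := deltaOp M (L ^ kk) a) (fun x => sum_coverH_sq (M := M) (n := L ^ kk) (w := L ^ m) (q := L) x) hloc
  refine ⟨⟨lap_comp_glueInv hunit h291, glueInv_comp_lap hunit h291, (eq_glueInv_of_comp_lap hunit h291 (gOp_comp_deltaOp M (L ^ kk) a hn ha)).symm⟩, ?_⟩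
  -- the machine's letter: parametrix (cut) + remainder + resummation, `w`-live
  have hind : ∀ (k : Fin (d + 1) → ZMod (2 * L)) (y y' : Tor M), 0 ≤ ind (g := unitTorusGeo L kk M) ((cubeBlocks M (coverCorner M (L ^ m) L (coverMargin L m) k) (L * L ^ m) : Finset (Tor M)) : Set (Tor M)) y *
      ind (g := unitTorusGeo L kk M) ((cubeBlocks M (coverCorner M (L ^ m) L (coverMargin L m) k) (L * L ^ m) : Finset (Tor M)) : Set (Tor M)) y' :=
    fun k y y' => mul_nonneg (ind_nonneg _ _) (ind_nonneg _ _)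
  have hGc : ∀ k : Fin (d + 1) → ZMod (2 * L),
      HasMaj (BlockNorm.ofBlocks (unitTorusGeo L kk M) (fun b : Tor (fine (L ^ kk) M) × Fin (d + 1) => blockOf (L ^ kk) M b.1))
        (BlockNorm.ofBlocks (unitTorusGeo L kk M) (fun b : Tor (fine (L ^ kk) M) × Fin (d + 1) => blockOf (L ^ kk) M b.1))
        (mulOp (chiCube M (L ^ kk) (coverCorner M (L ^ m) L (coverMargin L m) k) (L * L ^ m)) ∘ₗ knitG d L m kk (L ^ kk) hL a k)
        (fun y y' => ind ((cubeBlocks M (coverCorner M (L ^ m) L (coverMargin L m) k) (L * L ^ m) : Finset (Tor M)) : Set (Tor M)) y *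
          ind ((cubeBlocks M (coverCorner M (L ^ m) L (coverMargin L m) k) (L * L ^ m) : Finset (Tor M)) : Set (Tor M)) y' * (β * Real.exp (-(min δ₀ δ₁ / 2 * tdistT M y y')))) := fun k =>
    hasMaj_rate_le (hind k) hβ0 (by linarith [min_le_left δ₀ δ₁] : min δ₀ δ₁ / 2 ≤ δ₀)
      (hasMaj_chiCube_symOp_comp (L := L) (k := kk) (c := coverCorner M (L ^ m) L (coverMargin L m) k) (S := L * L ^ m) hC.le hδ₀.le hM'
        (hasMaj_comp_mulOp_chiInt (c := coverCorner M (L ^ m) L (coverMargin L m) k) (S := L * L ^ m) hC.le hG))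
  have hcut : ∀ k : Fin (d + 1) → ZMod (2 * L), mulOp (knitH d L m kk (L ^ kk) hL k) ∘ₗ mulOp (chiCube M (L ^ kk) (coverCorner M (L ^ m) L (coverMargin L m) k) (L * L ^ m)) =
      mulOp (knitH d L m kk (L ^ kk) hL k) := fun k =>
    hcube_cut (2 * L) (coverXi M (L ^ kk) (L ^ m)) (bshiftEquiv M (L ^ kk)) 0 (chiCube_coverCorner_eq_one (M := M) (n := L ^ kk) (m₀ := coverMargin L m) hM hw hfit1 0 k)
  have hP := hasMaj_parametrix (g := unitTorusGeo L kk M) (fun b : Tor (fine (L ^ kk) M) × Fin (d + 1) => blockOf (L ^ kk) M b.1)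
    (fun k => ((cubeBlocks M (coverCorner M (L ^ m) L (coverMargin L m) k) (L * L ^ m) : Finset (Tor M)) : Set (Tor M))) (h := knitH d L m kk (L ^ kk) hL) hβ0 hh hN hGc
  have ecut := parametrix_cut (G := knitG d L m kk (L ^ kk) hL a) hcut
  have hP' : HasMaj (BlockNorm.ofBlocks (unitTorusGeo L kk M) (fun b : Tor (fine (L ^ kk) M) × Fin (d + 1) => blockOf (L ^ kk) M b.1))
      (BlockNorm.ofBlocks (unitTorusGeo L kk M) (fun b : Tor (fine (L ^ kk) M) × Fin (d + 1) => blockOf (L ^ kk) M b.1))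
      (parametrix (knitH d L m kk (L ^ kk) hL) (knitG d L m kk (L ^ kk) hL a)) (fun y y' => Nov * β * Real.exp (-(min δ₀ δ₁ / 2 * tdistT M y y'))) :=
    hP.congr fun μ => LinearMap.congr_fun ecut μ
  have hR' : HasMaj (BlockNorm.ofBlocks (unitTorusGeo L kk M) (fun b : Tor (fine (L ^ kk) M) × Fin (d + 1) => blockOf (L ^ kk) M b.1))
      (BlockNorm.ofBlocks (unitTorusGeo L kk M) (fun b : Tor (fine (L ^ kk) M) × Fin (d + 1) => blockOf (L ^ kk) M b.1))
      (remainder (deltaOp M (L ^ kk) a) (knitH d L m kk (L ^ kk) hL) (knitG d L m kk (L ^ kk) hL a))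
      (fun y y' => Nov * κ₀ / ((L ^ m : ℕ) : ℝ) * Real.exp (-(min δ₀ δ₁ / 2 * tdistT M y y'))) := hR.mono fun y y' => le_of_eq (by ring)
  have hdec := hasMaj_glueInv_of_M (g := unitTorusGeo L kk M) (fun b : Tor (fine (L ^ kk) M) × Fin (d + 1) => blockOf (L ^ kk) M b.1) (triangle254_unitTorusGeo L kk M)
    (unitTorusGeo_dist_nonneg L kk M) (unitTorusGeo_dist_self L kk M) hrow (by positivity) hcr (mul_nonneg (by positivity) hβ0) (mul_nonneg (by positivity) hκ₀) hwpos hMge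
    (by linarith : 2 * (min δ₀ δ₁ / 4) ≤ min δ₀ δ₁ / 2) hP' hR'
  refine hdec.mono fun y y' => ?_
  rw [show min δ₀ δ₁ / 2 - min δ₀ δ₁ / 4 = min δ₀ δ₁ / 4 by ring]
  exact mul_le_mul_of_nonneg_right (by linarith) (Real.exp_nonneg _)

end Knit

end Summit.QuantumFields.YangMills.BalabanUVNodes.N15.Gluing

end
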